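import Mathlib
import Literature.Analysis.FluidPDE.SwirlMaximumPrinciple
import HarnessLib

/-!
# A weak maximum principle on the whole space for subsolutions with linearly growing drift
(route `SymmetryModuliCount`, item stmt-NavierStokesRegularity-14340 `StretchingCertificateComparison`,
helper file)

For the certificate comparison theorem the tree's abstract weak maximum principle on compact
cylinders (`weak_max_principle`, Lieberman 1996, Ch. II, Lemma 2.1/2.3) is combined with the
quadratic barrier `M + ε e^{β(t−T₁)}(1 + |x|²)` of `SwirlMaximumPrinciple` to give the whole-space
statement actually consumed there:

* `le_of_subsolution_linear_drift` — let `P : ℝ → (EuclideanSpace ℝ (Fin 3)) → ℝ` be jointly continuous on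
  `[T₁, T₂] × (EuclideanSpace ℝ (Fin 3))`, with `C²` slices and a time derivative `Pₜ` on `(T₁, T₂]`, bounded above by `B`,
  and suppose the one-point inequality `Pₜ ≤ ΔP + K(1 + |x|)‖∇P‖` (which is what any
  drift–diffusion inequality `Pₜ ≤ ΔP − b·∇P` with `|b| ≤ K(1 + |x|)` gives). If `P(T₁, ·) ≤ M`
  then `P ≤ M` on `[T₁, T₂] × (EuclideanSpace ℝ (Fin 3))`.

No sign condition on `P`, no lower bound, no decay: the linear growth of the drift is absorbed by
the exponential-in-time factor of the barrier (`β = 7 + 3K`).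
-/

noncomputable section

set_option linter.dupNamespace false

open Set Function Filter Metric
open scoped RealInnerProductSpace Laplacian ContDiff Topology

namespace Summit.NavierStokesRegularity.NavierStokesRegularity.Theorems

open Literature.Analysis Literature.Analysis.FluidPDE

/-- Operator norm of the gradient of the quadratic barrier: `‖c • 2⟪x, ·⟫‖ ≤ 2|c| ‖x‖`. [folklore] -/
theorem norm_barrier_fderiv_le (c : ℝ) (x : (EuclideanSpace ℝ (Fin 3))) :
    ‖c • ((2 : ℕ) • (innerSL ℝ x : (EuclideanSpace ℝ (Fin 3)) →L[ℝ] ℝ))‖ ≤ 2 * |c| * ‖x‖ := by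
  rw [norm_smul, Real.norm_eq_abs]
  have h2 : ‖(2 : ℕ) • (innerSL ℝ x : (EuclideanSpace ℝ (Fin 3)) →L[ℝ] ℝ)‖ ≤ (2 : ℕ) * ‖(innerSL ℝ x : (EuclideanSpace ℝ (Fin 3)) →L[ℝ] ℝ)‖ :=
    norm_nsmul_le
  rw [innerSL_apply_norm] at h2
  push_cast at h2
  nlinarith [abs_nonneg c, norm_nonneg x]

/-- **Weak maximum principle on `[T₁, T₂] × (EuclideanSpace ℝ (Fin 3))` for bounded subsolutions with linearly growing
drift.** Let `P` be jointly continuous on `[T₁, T₂] × (EuclideanSpace ℝ (Fin 3))`, with `C²` slices `P t` and a time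
derivative `Pₜ t x` for `t ∈ (T₁, T₂]`, bounded above (`P ≤ B`), and satisfying at every point of
`(T₁, T₂] × (EuclideanSpace ℝ (Fin 3))` the inequality `Pₜ ≤ ΔP + K (1 + ‖x‖) ‖∇P‖` (`K ≥ 0`). If `P(T₁, ·) ≤ M` then
`P ≤ M` on `[T₁, T₂] × (EuclideanSpace ℝ (Fin 3))`. Proof: apply `weak_max_principle` to
`w = P − M − ε e^{β(t−T₁)}(1 + ‖x‖²)`, `β = 7 + 3K`, on the balls `‖x‖ ≤ R`, `R ≥ (B − M)/ε`: at a
critical point `∇P = 2c⟪x, ·⟫`, `ΔP ≤ 6c` (`c = ε e^{β(t−T₁)}`), so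
`Pₜ ≤ 6c + 2cK(1 + ‖x‖)‖x‖ ≤ (6 + 3K) c (1 + ‖x‖²) < ∂ₜ` of the barrier; then let `ε → 0`.
[cite: Lieberman1996, Ch. II Lemma 2.1 and Lemma 2.3; Thm. 2.4 (unbounded domains)] -/
theorem le_of_subsolution_linear_drift {T₁ T₂ M B K : ℝ} (hK : 0 ≤ K)
    {P Pₜ : ℝ → (EuclideanSpace ℝ (Fin 3)) → ℝ}
    (hc : ContinuousOn (uncurry P) (Icc T₁ T₂ ×ˢ univ))
    (h2 : ∀ t ∈ Ioc T₁ T₂, ContDiff ℝ 2 (P t))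
    (ht : ∀ t ∈ Ioc T₁ T₂, ∀ x, HasDerivAt (fun s => P s x) (Pₜ t x) t)
    (hsub : ∀ t ∈ Ioc T₁ T₂, ∀ x,
      Pₜ t x ≤ (Δ (P t)) x + K * (1 + ‖x‖) * ‖fderiv ℝ (P t) x‖)
    (hB : ∀ t ∈ Icc T₁ T₂, ∀ x, P t x ≤ B) (hM : ∀ x, P T₁ x ≤ M) :
    ∀ t ∈ Icc T₁ T₂, ∀ x, P t x ≤ M := by
  -- constants of the barrier
  set β : ℝ := 7 + 3 * K with hβ
  have hβ0 : 0 ≤ β := by rw [hβ]; positivity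
  -- the claim for every `ε > 0`, on every large ball
  suffices key : ∀ ε : ℝ, 0 < ε → ∀ R : ℝ, (B - M) / ε ≤ R → 0 ≤ R →
      ∀ t ∈ Icc T₁ T₂, ∀ x ∈ closedBall (0 : (EuclideanSpace ℝ (Fin 3))) R,
        P t x - (M + ε * Real.exp (β * (t - T₁)) * (1 + ‖x‖ ^ 2)) ≤ 0 by
    intro t htI x
    refine le_of_forall_pos_le_add fun η hη => ?_
    set C : ℝ := Real.exp (β * (t - T₁)) * (1 + ‖x‖ ^ 2) with hC
    have hCpos : 0 < C := by positivity
    have h := key (η / C) (div_pos hη hCpos) (max (max ((B - M) / (η / C)) ‖x‖) 0)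
      ((le_max_left _ _).trans (le_max_left _ _)) (le_max_right _ _) t htI x
      (mem_closedBall_zero_iff.2 ((le_max_right _ _).trans (le_max_left _ _)))
    have e : η / C * Real.exp (β * (t - T₁)) * (1 + ‖x‖ ^ 2) = η := by
      rw [hC]; field_simp
    rw [e] at h
    linarith
  intro ε hε R hR hR0
  -- the comparison function and its time derivative
  set w : ℝ → (EuclideanSpace ℝ (Fin 3)) → ℝ := fun t x =>
    P t x - (M + ε * Real.exp (β * (t - T₁)) * (1 + ‖x‖ ^ 2)) with hw
  set wₜ : ℝ → (EuclideanSpace ℝ (Fin 3)) → ℝ := fun t x =>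
    Pₜ t x - β * (ε * Real.exp (β * (t - T₁)) * (1 + ‖x‖ ^ 2)) with hwₜ
  set Kc : Set (EuclideanSpace ℝ (Fin 3)) := closedBall 0 R with hKc
  set U : Set (EuclideanSpace ℝ (Fin 3)) := ball 0 R with hU
  have hKcc : IsCompact Kc := isCompact_closedBall _ _
  have hUo : IsOpen U := isOpen_ball
  have hUK : U ⊆ Kc := ball_subset_closedBall
  -- (a) joint continuity
  have hcw : ContinuousOn (uncurry w) (Icc T₁ T₂ ×ˢ Kc) := by
    have h1 : ContinuousOn (uncurry P) (Icc T₁ T₂ ×ˢ Kc) := hc.mono (prod_mono Subset.rfl (subset_univ _))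
    have h2 : Continuous fun p : ℝ × (EuclideanSpace ℝ (Fin 3)) =>
        M + ε * Real.exp (β * (p.1 - T₁)) * (1 + ‖p.2‖ ^ 2) := by fun_prop
    exact (h1.sub h2.continuousOn).congr fun p _ => rfl
  -- (b) smooth slices
  have h2w : ∀ t ∈ Ioc T₁ T₂, ContDiff ℝ 2 (w t) := fun t htI =>
    (h2 t htI).sub (contDiff_barrier M (ε * Real.exp (β * (t - T₁))))
  -- (c) the (left) time derivative
  have htw : ∀ t ∈ Ioc T₁ T₂, ∀ x ∈ U, HasDerivWithinAt (fun s => w s x) (wₜ t x) (Icc T₁ t) t := by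
    intro t htI x _
    have hP := ht t htI x
    have hexp : HasDerivAt (fun s => M + ε * Real.exp (β * (s - T₁)) * (1 + ‖x‖ ^ 2))
        (ε * (Real.exp (β * (t - T₁)) * β) * (1 + ‖x‖ ^ 2)) t := by
      have h1 : HasDerivAt (fun s => Real.exp (β * (s - T₁))) (Real.exp (β * (t - T₁)) * β) t := by
        have := (((hasDerivAt_id t).sub_const T₁).const_mul β).exp
        simpa using this
      exact ((h1.const_mul ε).mul_const (1 + ‖x‖ ^ 2)).const_add M
    have h := (hP.sub hexp).hasDerivWithinAt (s := Icc T₁ t)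
    simp only [hw, hwₜ]
    exact h.congr_deriv (by ring)
  -- (d) the sub-solution implication
  have hsubw : ∀ t ∈ Ioc T₁ T₂, ∀ x ∈ U, fderiv ℝ (w t) x = 0 → (Δ (w t)) x ≤ 0 → wₜ t x ≤ 0 := by
    intro t htI x _ hgrad hlap
    set c : ℝ := ε * Real.exp (β * (t - T₁)) with hcdef
    have hc0 : 0 < c := by positivity
    -- gradient at the critical point
    have hPd : DifferentiableAt ℝ (P t) x := ((h2 t htI).differentiable two_ne_zero) x
    have hBd := hasFDerivAt_barrier M c x
    have hwderiv : HasFDerivAt (w t) (fderiv ℝ (P t) x -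
        c • ((2 : ℕ) • (innerSL ℝ x : (EuclideanSpace ℝ (Fin 3)) →L[ℝ] ℝ))) x := by
      have h := hPd.hasFDerivAt.sub hBd
      simp only [hw, hcdef]
      exact h
    have hDeq : fderiv ℝ (P t) x = c • ((2 : ℕ) • (innerSL ℝ x : (EuclideanSpace ℝ (Fin 3)) →L[ℝ] ℝ)) := by
      have := hwderiv.fderiv
      rw [hgrad] at this
      exact (sub_eq_zero.1 this.symm)
    have hnormD : ‖fderiv ℝ (P t) x‖ ≤ 2 * c * ‖x‖ := by
      rw [hDeq]
      have := norm_barrier_fderiv_le c x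
      rwa [abs_of_pos hc0] at this
    -- Laplacian at the critical point
    have hΔeq : (Δ (w t)) x = (Δ (P t)) x - 6 * c := by
      have h1 : ContDiffAt ℝ 2 (P t) x := (h2 t htI).contDiffAt
      have h3 : ContDiffAt ℝ 2 (fun y : (EuclideanSpace ℝ (Fin 3)) => (M + c * (1 + ‖y‖ ^ 2) : ℝ)) x :=
        (contDiff_barrier M c).contDiffAt
      have h4 := h1.laplacian_sub h3
      have hfun : w t = (P t) - fun y : (EuclideanSpace ℝ (Fin 3)) => (M + c * (1 + ‖y‖ ^ 2) : ℝ) := by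
        funext y
        simp only [hw, hcdef, Pi.sub_apply]
      rw [hfun, h4, laplacian_barrier]
    have hΔ : (Δ (P t)) x ≤ 6 * c := by rw [hΔeq] at hlap; linarith
    -- the one-point inequality
    have hPt := hsub t htI x
    have hdrift : K * (1 + ‖x‖) * ‖fderiv ℝ (P t) x‖ ≤ K * (1 + ‖x‖) * (2 * c * ‖x‖) :=
      mul_le_mul_of_nonneg_left hnormD (by positivity)
    have hx2 : K * (1 + ‖x‖) * (2 * c * ‖x‖) ≤ 3 * K * (c * (1 + ‖x‖ ^ 2)) := by
      have hx0 := norm_nonneg x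
      have e : 3 * K * (c * (1 + ‖x‖ ^ 2)) - K * (1 + ‖x‖) * (2 * c * ‖x‖) =
          K * c * ((1 - ‖x‖) ^ 2 + 2) := by ring
      have : 0 ≤ K * c * ((1 - ‖x‖) ^ 2 + 2) := by positivity
      linarith
    have h6 : 6 * c ≤ 6 * (c * (1 + ‖x‖ ^ 2)) := by nlinarith [sq_nonneg ‖x‖]
    have e3 : wₜ t x = Pₜ t x - β * (c * (1 + ‖x‖ ^ 2)) := by
      simp only [hwₜ, hcdef]
    rw [e3, hβ]
    nlinarith [hPt, hdrift, hx2, h6, hc0, sq_nonneg ‖x‖]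
  -- (e) the parabolic boundary: `t = T₁`
  have hbot : ∀ x ∈ Kc, w T₁ x ≤ 0 := by
    intro x _
    simp only [hw, sub_self, mul_zero, Real.exp_zero, mul_one]
    have h1 := hM x
    have h3 : 0 ≤ ε * (1 + ‖x‖ ^ 2) := by positivity
    linarith
  -- (f) the parabolic boundary: the sphere `‖x‖ = R`
  have hlat : ∀ t ∈ Icc T₁ T₂, ∀ x ∈ Kc \ U, w t x ≤ 0 := by
    intro t htI x hx
    have hexp1 : 1 ≤ Real.exp (β * (t - T₁)) :=
      Real.one_le_exp (mul_nonneg hβ0 (by linarith [htI.1]))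
    have hH : ε * (1 + ‖x‖ ^ 2) ≤ ε * Real.exp (β * (t - T₁)) * (1 + ‖x‖ ^ 2) := by
      have : ε * (1 + ‖x‖ ^ 2) * 1 ≤ ε * (1 + ‖x‖ ^ 2) * Real.exp (β * (t - T₁)) :=
        mul_le_mul_of_nonneg_left hexp1 (by positivity)
      linarith
    have hxK : ‖x‖ ≤ R := mem_closedBall_zero_iff.1 hx.1
    have hxR : ‖x‖ = R := by
      have hnot : x ∉ ball (0 : (EuclideanSpace ℝ (Fin 3))) R := hx.2
      have : R ≤ ‖x‖ := by simpa using hnot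
      exact le_antisymm hxK this
    have hPB := hB t htI x
    have h2' : B - M ≤ ε * (1 + ‖x‖ ^ 2) := by
      rw [hxR]
      have h1 : B - M ≤ R * ε := (div_le_iff₀ hε).1 hR
      nlinarith [sq_nonneg (R - 1), hε]
    simp only [hw]
    linarith
  exact weak_max_principle hKcc hUo hUK hcw h2w htw hsubw hbot hlat

end Summit.NavierStokesRegularity.NavierStokesRegularity.Theorems

end
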